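import Summits.ResolutionOfSingularities.ResolutionOfSingularities.Theorems.PurelyInseparableDim4WinCertLeafTorusCheck
import Summits.ResolutionOfSingularities.ResolutionOfSingularities.Theorems.PurelyInseparableDim4InScopeWinCertHorner
import HarnessLib
import HarnessLib.Audit.Tags

/-!
# Purely inseparable fourfolds — FAST block checker for the TORUS certificate format (Horner replies)
# [OURS · counted 0 · a kernel-reducible certificate format for OUR frame v4, not about resolution]

Census cell «res-dim4-pi» (D-0157 DOOR 2); seat res-dim4-p-14 g4 (E5 filer designate, desk WORD #207 (a)).
res-rescue-typ-3 g10's torus-format checker `twinCertBL p q leafOK` / block form `twinCertBL2` (✓ `…WinCertLeafTorusCheck`)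
spends almost all of its kernel time in the REPLY clause `lrepliesOKB` (every `k`-rational reply of player B is tested by
res-dim4-p-14's ORIGINAL in-scope reply test `InScopeWinCert.ireplyOK`: un-normalised chart transform + translation, then the
full `q`-fold test `equiB`).  On the E5 chain (root S1a-5637307d28) block 72 alone needs ≈ 225 s of kernel work (row 7: 111 s, of
which 90 s in `lrepliesOKB`) and the gate node aborts on the whole block (p712378 bounce, p713942 `node-rc=134`).

This file is a DROP-IN REPLACEMENT FOR THE PROOFS, not for the statements: the same rows, the same `leafOK`, the same covers,
flats, torus flats and leaves, but the reply clause uses res-dim4-p-13 g4's HORNER reply test `InScopeWinCert.ireplyTOK`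
(✓ `…InScopeWinCertHorner` p713047: Hasse–Taylor equimultiplicity test `equiHB` + Horner/normalising translation `stepDH`,
with the pointwise implication `ireplyOK_of_ireplyTOK`).  Contents:

* `lrepliesTOKB` + `lrepliesOKB_of_lrepliesTOKB` (pointwise, via `ireplyOK_of_ireplyTOK`);
* `trowTOKL` + `trowOKL_of_trowTOKL` (the torus row check with the fast reply clause; every other clause verbatim);
* `twinCertTBL2` + **`twinCertBL2_of_twinCertTBL2`** (fast block form ⇒ typ-3's block form), so a block theorem
  `twinCertBL p q leafOK (A ++ B) = true` is obtained as `twinCertBL_append_of p q leafOK (twinCertBL2_of_twinCertTBL2 p q leafOK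
  (by decide +kernel)) hB` — DATA FILES, BLOCK STATEMENTS AND HEADLINES OF A CHAIN STAY BYTE-IDENTICAL, only the proof term changes;
* `twinCertBL2_append_of` (sub-block splitting: `twinCertBL2 (A₁ ++ A₂) B` from `twinCertBL2 A₁ (A₂ ++ B)` and `twinCertBL2 A₂ B`),
  the fallback when even a fast block exceeds the per-`decide` ceiling of the gate node.

Soundness is by REDUCTION ONLY (no new semantics): everything lands in typ-3's `twinCertBL`, whose soundness
(`forall_inScopeStateWins_of_twinCertBL5` etc.) is untouched.  Nothing here proves F4-C(2,2) or resolution of singularities in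
dimension ≥ 4 / characteristic `p`; counted 0; AI kernel work, weaker than expert review.
bears_on: LADDER-RESOLUTION:D157-DOOR2 (res-dim4-pi · ∀K column · E5 chain · fast torus block checker).
Supports stmt-ResolutionOfSingularities-16155 (helper).
-/

set_option linter.dupNamespace false -- mandated namespace of this single-conjunct summit

open MvPolynomial Finset
open scoped BigOperators

namespace Summit.ResolutionOfSingularities.ResolutionOfSingularities.Theorems.PIDim4

namespace WinCertLeaf

open Literature.AlgebraicGeometry.Resolution
open Literature.AlgebraicGeometry.Resolution.CentreBlowup
open StepKit WinCertSound InScopeWinCert ScopeCover ScopeBlind WinCertAllFields FlatAbsorb WinCertFlat WinCertSubst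
open TorusFlat

section Checker

variable {k : Type} [Field k] [DecidableEq k]

variable {C : Type}

variable [Fintype k]

/-- **Fast reply clause**: every `k`-rational reply is harmless by the HORNER reply test (`ireplyTOK`), or on a flat, or on a
leaf. [folklore] -/
def lrepliesTOKB (q : ℕ) (rest : LCert k C) (s : SData 4 k) (S : Finset (Fin 4)) (flats : List (Flat k))
    (leaves : List (ILeaf k C)) : Bool :=
  decide (∀ j ∈ S, ∀ b : Fin 4 → k, b j = 0 →
    ireplyTOK q (rest.map fun r : LRow k C => r.1) s S j b = true ∨
      (∃ φ ∈ flats, φ.j = j ∧ onFlatB φ b = true) ∨ (∃ ℓ ∈ leaves, ℓ.j = j ∧ onLeafBL ℓ b = true))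

/-- The fast reply clause implies typ-3's reply clause (pointwise `ireplyOK_of_ireplyTOK`). [folklore] -/
theorem lrepliesOKB_of_lrepliesTOKB {q : ℕ} {rest : LCert k C} {s : SData 4 k} {S : Finset (Fin 4)} {flats : List (Flat k)}
    {leaves : List (ILeaf k C)} (h : lrepliesTOKB q rest s S flats leaves = true) :
    lrepliesOKB q rest s S flats leaves = true := by
  unfold lrepliesTOKB at h
  unfold lrepliesOKB
  rw [decide_eq_true_eq] at h ⊢
  intro j hj b hb
  rcases h j hj b hb with h1 | h2 | h3
  · exact Or.inl (ireplyOK_of_ireplyTOK h1)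
  · exact Or.inr (Or.inl h2)
  · exact Or.inr (Or.inr h3)

/-- **Fast row check** of the torus format: typ-3's `trowOKL` with the reply clause replaced by `lrepliesTOKB`; the blindness,
permissibility, flat, torus-flat, leaf and cover clauses are verbatim. [folklore] -/
def trowTOKL (p q : ℕ) (leafOK : SData 4 k → Finset (Fin 4) → ILeaf k C → Bool) (rest : List (TRow k C))
    (row : TRow k C) : Bool :=
  lblindOKS q row.1 || !(permB q Finset.univ row.1.1.1.L) ||
    (permB q row.1.1.2.1 row.1.1.1.L &&
      lrepliesTOKB q (rest.map Prod.fst) row.1.1.1 row.1.1.2.1 (allFlats row) row.1.2.2.2 &&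
      lflatsOKBS q (rest.map Prod.fst) row.1.1.1 row.1.1.2.1 row.1.2.2.1 &&
      decide (∀ ψ ∈ row.2, ltorusFlatOKB q (rest.map Prod.fst) row.1.1.1 row.1.1.2.1 ψ.1 ψ.2 = true) &&
      lleavesOKB leafOK row.1.1.1 row.1.1.2.1 row.1.2.2.2 &&
      lcoversOKB p q row.1.1.1 row.1.1.2.1 row.1.2.1 (allFlats row) row.1.2.2.2)

/-- The fast row check implies typ-3's row check. [folklore] -/
theorem trowOKL_of_trowTOKL {p q : ℕ} {leafOK : SData 4 k → Finset (Fin 4) → ILeaf k C → Bool} {rest : List (TRow k C)}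
    {row : TRow k C} (h : trowTOKL p q leafOK rest row = true) : trowOKL p q leafOK rest row = true := by
  unfold trowTOKL at h
  unfold trowOKL
  rw [Bool.or_eq_true, Bool.or_eq_true] at h ⊢
  rcases h with (h | h) | h
  · exact Or.inl (Or.inl h)
  · exact Or.inl (Or.inr h)
  · refine Or.inr ?_
    simp only [Bool.and_eq_true] at h ⊢
    obtain ⟨⟨⟨⟨⟨hp, hr⟩, hf⟩, ht⟩, hl⟩, hc⟩ := h
    exact ⟨⟨⟨⟨⟨hp, lrepliesOKB_of_lrepliesTOKB hr⟩, hf⟩, ht⟩, hl⟩, hc⟩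

/-- **Fast block form**: the rows of `A` checked (fast) against their tails inside `A ++ B`. [folklore] -/
def twinCertTBL2 (p q : ℕ) (leafOK : SData 4 k → Finset (Fin 4) → ILeaf k C → Bool) :
    List (TRow k C) → List (TRow k C) → Bool
  | [], _ => true
  | row :: A, B => trowTOKL p q leafOK (A ++ B) row && twinCertTBL2 p q leafOK A B

/-- **The fast block form implies typ-3's block form** — plug into `twinCertBL_append_of`. [folklore] -/
theorem twinCertBL2_of_twinCertTBL2 (p q : ℕ) (leafOK : SData 4 k → Finset (Fin 4) → ILeaf k C → Bool) :
    ∀ {A B : List (TRow k C)}, twinCertTBL2 p q leafOK A B = true → twinCertBL2 p q leafOK A B = true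
  | [], _, _ => rfl
  | row :: A, B, h => by
    rw [show twinCertTBL2 p q leafOK (row :: A) B = (trowTOKL p q leafOK (A ++ B) row && twinCertTBL2 p q leafOK A B)
      from rfl, Bool.and_eq_true] at h
    rw [show twinCertBL2 p q leafOK (row :: A) B = (trowOKL p q leafOK (A ++ B) row && twinCertBL2 p q leafOK A B)
      from rfl, Bool.and_eq_true]
    exact ⟨trowOKL_of_trowTOKL h.1, twinCertBL2_of_twinCertTBL2 p q leafOK h.2⟩

/-- **Sub-block splitting** for typ-3's block form: a block `A₁ ++ A₂` over `B` checks iff `A₁` checks over `A₂ ++ B` and `A₂`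
over `B`. [folklore] -/
theorem twinCertBL2_append_of (p q : ℕ) (leafOK : SData 4 k → Finset (Fin 4) → ILeaf k C → Bool) :
    ∀ {A₁ A₂ B : List (TRow k C)}, twinCertBL2 p q leafOK A₁ (A₂ ++ B) = true → twinCertBL2 p q leafOK A₂ B = true →
      twinCertBL2 p q leafOK (A₁ ++ A₂) B = true
  | [], _, _, _, h₂ => by rwa [List.nil_append]
  | row :: A₁, A₂, B, h₁, h₂ => by
    rw [show twinCertBL2 p q leafOK (row :: A₁) (A₂ ++ B) =
        (trowOKL p q leafOK (A₁ ++ (A₂ ++ B)) row && twinCertBL2 p q leafOK A₁ (A₂ ++ B)) from rfl, Bool.and_eq_true] at h₁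
    rw [List.cons_append, show twinCertBL2 p q leafOK (row :: (A₁ ++ A₂)) B =
        (trowOKL p q leafOK (A₁ ++ A₂ ++ B) row && twinCertBL2 p q leafOK (A₁ ++ A₂) B) from rfl, Bool.and_eq_true,
      List.append_assoc]
    exact ⟨h₁.1, twinCertBL2_append_of p q leafOK h₁.2 h₂⟩

/-- Sub-block splitting for the FAST block form (same statement). [folklore] -/
theorem twinCertTBL2_append_of (p q : ℕ) (leafOK : SData 4 k → Finset (Fin 4) → ILeaf k C → Bool) :
    ∀ {A₁ A₂ B : List (TRow k C)}, twinCertTBL2 p q leafOK A₁ (A₂ ++ B) = true → twinCertTBL2 p q leafOK A₂ B = true →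
      twinCertTBL2 p q leafOK (A₁ ++ A₂) B = true
  | [], _, _, _, h₂ => by rwa [List.nil_append]
  | row :: A₁, A₂, B, h₁, h₂ => by
    rw [show twinCertTBL2 p q leafOK (row :: A₁) (A₂ ++ B) =
        (trowTOKL p q leafOK (A₁ ++ (A₂ ++ B)) row && twinCertTBL2 p q leafOK A₁ (A₂ ++ B)) from rfl, Bool.and_eq_true] at h₁
    rw [List.cons_append, show twinCertTBL2 p q leafOK (row :: (A₁ ++ A₂)) B =
        (trowTOKL p q leafOK (A₁ ++ A₂ ++ B) row && twinCertTBL2 p q leafOK (A₁ ++ A₂) B) from rfl, Bool.and_eq_true,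
      List.append_assoc]
    exact ⟨h₁.1, twinCertTBL2_append_of p q leafOK h₁.2 h₂⟩

/-- **A whole certificate from its fast block form over the empty tail.** [folklore] -/
theorem twinCertBL_of_twinCertTBL2_nil (p q : ℕ) (leafOK : SData 4 k → Finset (Fin 4) → ILeaf k C → Bool)
    {A : List (TRow k C)} (h : twinCertTBL2 p q leafOK A [] = true) : twinCertBL p q leafOK A = true := by
  rw [← List.append_nil A]
  exact twinCertBL_append_of p q leafOK (twinCertBL2_of_twinCertTBL2 p q leafOK h) rfl

end Checker

end WinCertLeaf

end Summit.ResolutionOfSingularities.ResolutionOfSingularities.Theorems.PIDim4
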